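import Summits.NavierStokesRegularity.FunctionalMining.TopEigDirTopEigSemicontinuous
import Summits.NavierStokesRegularity.FunctionalMining.TopEigSimpleGap
import HarnessLib

/-!
# FunctionalMining — the Danskin density `x ↦ μ(S(x); S(w)(x))` on the torus is upper semicontinuous,
# and continuous on the simple set `U_s = {λ₂ < λ₁}` (F1 PART I, Remark (1d), torus reading)

Search for candidate a priori estimates; no regularity claim. Cell `pub-nsfunc`, prove seat
(gen 23). Torus reading of `TopEigDirTopEigSemicontinuous.lean`: for smooth fields `v`, `w` on `T^d`
the density of the first variation / Danskin formula (gen 21: `T(v) = −∫qλ₁^{q−1}μ(S;ΔS)`,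
`(d/dt)⁺Φ_q(v+tw) = ∫qλ₁^{q−1}μ(S(v);S(w))`),

* `TopEig.upperSemicontinuous_dirTopEig_strainFlat` — `x ↦ μ(S(v)(x); S(w)(x))` is upper
  semicontinuous on `T^d` (composition of the usc `μ` with the continuous `x ↦ (S(v)(x), S(w)(x))`);
* `TopEig.continuousAt_dirTopEig_strainFlat_of_midEig_lt` — on `T³` it is continuous at every point
  of `U_s = {λ₂ < λ₁}` (there `μ = e₁ᵀS(w)e₁`).

[ours; folklore]
-/

noncomputable section

open Filter Topology Set Matrix

namespace Summit.NavierStokesRegularity.FunctionalMining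

open Literature.Analysis Literature.Analysis.FunctionSpaces Literature.Analysis.FunctionSpaces.Torus
  SharpClass.DirectorForm

namespace TopEig

/-- **The Danskin density is upper semicontinuous on the torus**: for smooth `v`, `w` on `T^d`,
`x ↦ μ(S(v)(x); S(w)(x))` is upper semicontinuous. [ours; F1 PART I Remark (1d)] -/
theorem upperSemicontinuous_dirTopEig_strainFlat {d : Type*} [Fintype d] [DecidableEq d] [Nonempty d]
    {v w : UnitAddTorus d → EuclideanSpace ℝ d} (hv : Torus.IsSmooth v) (hw : Torus.IsSmooth w) :
    UpperSemicontinuous fun x : UnitAddTorus d =>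
      dirTopEig (StrainL4.strainFlat v x) (StrainL4.strainFlat w x) := by
  have hg : Continuous fun x : UnitAddTorus d => (StrainL4.strainFlat v x, StrainL4.strainFlat w x) :=
    (StrainL4.continuous_strainFlat hv).prodMk (StrainL4.continuous_strainFlat hw)
  have h := (dirTopEig_upperSemicontinuous (d := d)).comp hg
  exact h

/-- **The Danskin density is continuous on the simple set**: for smooth `v`, `w` on `T³` and a point
`x` with `λ₂(x) < λ₁(x)`, `y ↦ μ(S(v)(y); S(w)(y))` is continuous at `x`. [ours; F1 PART I Remark (1d)] -/
theorem continuousAt_dirTopEig_strainFlat_of_midEig_lt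
    {v w : UnitAddTorus (Fin 3) → EuclideanSpace ℝ (Fin 3)} (hv : Torus.IsSmooth v)
    (hw : Torus.IsSmooth w) {x : UnitAddTorus (Fin 3)}
    (hx : torusStrainMidEig v x < torusStrainTopEig v x) :
    ContinuousAt (fun y : UnitAddTorus (Fin 3) =>
      dirTopEig (StrainL4.strainFlat v y) (StrainL4.strainFlat w y)) x := by
  obtain ⟨e, he1, hSe, hg, hgap⟩ := exists_gapForm_of_midEig_lt_topEig hx
  have he1' : e ∈ unitSphere (Fin 3) := he1
  have hgf := gapForm_of_eigenvector (torusStrainMatrix_isSymm v x) he1' hSe hgap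
  have hquad : quad (flat (torusStrainMatrix v x)) e = torusStrainTopEig v x := by
    rw [quad_flat, hSe, dotProduct_smul, he1, smul_eq_mul, mul_one]
  have hc := continuousAt_dirTopEig_of_gapForm he1' hg hgf hquad (StrainL4.strainFlat w x)
  rw [flat_torusStrainMatrix] at hc
  have hg' : ContinuousAt
      (fun y : UnitAddTorus (Fin 3) => (StrainL4.strainFlat v y, StrainL4.strainFlat w y)) x :=
    ((StrainL4.continuous_strainFlat hv).prodMk (StrainL4.continuous_strainFlat hw)).continuousAt
  have h := ContinuousAt.comp
    (g := fun p : EuclideanSpace ℝ (Fin 3 × Fin 3) × EuclideanSpace ℝ (Fin 3 × Fin 3) =>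
      dirTopEig p.1 p.2)
    (f := fun y : UnitAddTorus (Fin 3) => (StrainL4.strainFlat v y, StrainL4.strainFlat w y)) hc hg'
  exact h

end TopEig

end Summit.NavierStokesRegularity.FunctionalMining

end
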